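import Mathlib
import HarnessLib
import Literature.Analysis.FluidPDE.ClassicalSolutionRegion
import Literature.Analysis.FluidPDE.SwirlTransportProofs
import Summits.NavierStokesRegularity.NavierStokesRegularity.Theorems.PoloidalWindowDoorPoloidalWindowRigidityHyperbolicThickOfLocalOpen

/-!
# Route `PoloidalWindowDoor`, item `LrcModEntire` (stmt-NavierStokesRegularity-20428) and crux `PoloidalWindowRigidity` (K2, stmt-19708) —
# THE WHOLE THICK COLUMN from ONE type-blind pointwise-open local statement

Cell ns-regularity-ideate, seat ns-poloidal-K2-p4 gen 0 (stub-worker of the THICK column: `twist_split::stub_twistingThick` on item 20428 and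
`mixed_type::stub_hyperbolicThick` on crux 19708 — DIRECTOR-NS #70 (2); lead of record ns-poloidal-K2-p2; this file lands
`--supports stmt-NavierStokesRegularity-20428` as a helper; its 19708 corollary is the sibling file `…HyperbolicThickOfLocalThickOpen`).

After `…HyperbolicThickOfLocalOpen` (same seat, p576329: the hyperbolic thick stub of 19708 from the hyperbolic pointwise-open statement)
this file drops the type: the conversion «THICK window ⇒ a nonempty OPEN sub-window on which `∇ₕΛ ≠ 0`» (`Λ = ⟪∂₂vₕ, ∇ₕv₂⟫/|∇ₕv₂|²`, the
shear ratio) uses only the class, non-degeneracy of `∇ₕv₂` and the thick clause — no sign of the type scalar, no twist.  It is isolated here as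

* `exists_isOpen_slopeGrad_ne_zero` — class profile, poloidal; an open `W` in the backward slab with `∇ₕv₂ ≠ 0` on `W`, (TH) on NO nonempty open
  sub-window ⇒ `∃ U ⊆ W` open nonempty with `∂₀Λ ≠ 0 ∨ ∂₁Λ ≠ 0` at every point of `U` (if `∇ₕΛ ≡ 0` on `W`, a ball of `W` is (TH) with
  `m(t,z) := Λ(t, y₀ + (z − y₀₂)e₃)` by horizontal constancy and the frozen identity `…FirstIntegral` — contradiction; else `{∇ₕΛ ≠ 0} ∩ W` is open
  by joint analyticity of `Λ` and nonempty);

and then ONE local statement, TYPE-BLIND,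

  `hthick` := «no real-analytic classical NS pair `(u, q)` on a nonempty open `U` is at EVERY point of `U` poloidal ∧ frozen
  (`∂₂u₀·∂₁u₂ = ∂₂u₁·∂₀u₂`) ∧ non-degenerate ∧ twisting ∧ `∇ₕΛ ≠ 0`»

closes BY NAME:
* `stub_twistingThick_of_localThickOpen` — the registered stub `stub_twistingThick` of `Cruxes/LrcModEntire/Lines/twist_split.lean` (v4, item 20428)
  VERBATIM (conclusion: the germ trichotomy — obtained ex falso);
* (sibling file) `stub_hyperbolicThick_of_localThickOpen` — `mixed_type::stub_hyperbolicThick` (crux 19708) VERBATIM.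
Together with `stub_localTHEmpty` ((TH) column: `…TwistingTHLocal.stub_twistingTH_of_localEmpty`, `…HyperbolicTHOfLocalEmpty`) the twisting residue of
both items is thereby reduced to TWO named local PDE statements, `hempty` and `hthick`, each an all-orders compatibility question for an analytic NS germ
with OPEN pins on its jet (twist ≠ 0, and `∂_zμ ≠ 0` resp. `∇ₕΛ ≠ 0`).

Honest remarks: `hthick` is load-bearing in its momentum clause (refuter1 K-49: frozen analytic thick twisting KINEMATIC germs exist numerically,
j291279; K-50: without the frozen law even in closed form) and is refuted by ONE explicit thick twisting NS germ (cert-1's exact 8- and 13-jets show no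
certificate below jet order 9/14 exists).  WHAT THIS IS NOT: not a proof of either stub, of item 20428, of K2, or of anything about Navier–Stokes
regularity (Clay (A) untouched) — a kernel-checked localisation.  bears_on LADDER-NS N0, item 20428 (twist_split `stub_twistingThick`), crux 19708.
-/

noncomputable section

-- the summit and its single sub-problem share the name (CONVENTIONS §1), as in every Theorems file
set_option linter.dupNamespace false

namespace Summit.NavierStokesRegularity.NavierStokesRegularity.Theorems.PoloidalWindowDoorLrcModEntireTwistingThickOfLocalOpen

open Set Function Metric Filter
open scoped RealInnerProductSpace InnerProductSpace Topology
open Literature.Analysis Literature.Analysis.FluidPDE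
open Summit.NavierStokesRegularity.NavierStokesRegularity.Theorems
open Summit.NavierStokesRegularity.NavierStokesRegularity.Theorems.PoloidalWindowDoorPoloidalWindowRigidityWindow
open Summit.NavierStokesRegularity.NavierStokesRegularity.Theorems.LocalSineTubeDoorProfileAlignedWindowRigidityAncient
open Summit.NavierStokesRegularity.NavierStokesRegularity.Theorems.TubeAlternative.AnalyticPropagation
open Summit.NavierStokesRegularity.NavierStokesRegularity.Theorems.PoloidalWindowDoorPoloidalWindowRigidityK2OfLrcSlope
open Summit.NavierStokesRegularity.NavierStokesRegularity.Theorems.PoloidalWindowDoorPoloidalWindowRigidityHyperbolicThickOfLocalOpen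

variable {C : ℝ} {v : ℝ → EuclideanSpace ℝ (Fin 3) → EuclideanSpace ℝ (Fin 3)}

/-! ### THICK ⇒ an open sub-window with `∇ₕΛ ≠ 0` -/

/-- **A thick window of a class profile contains a nonempty open sub-window on which the horizontal gradient of the shear ratio
`Λ = ⟪∂₂vₕ, ∇ₕv₂⟫/|∇ₕv₂|²` vanishes nowhere.**  Hypotheses: the route's class, poloidal along `e₃`; `W` open nonempty in the backward slab with
`∇ₕv₂ ≠ 0` on `W`; for every `m : ℝ → ℝ → ℝ` and every nonempty open `W₁ ⊆ W` some point of `W₁` violates `∂₂v_b = m(t,y₂)∂_bv₂`. -/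
theorem exists_isOpen_slopeGrad_ne_zero (hrate : HasTypeITimeDecay C v)
    (hcont : ContinuousOn (uncurry v) (Iio (0 : ℝ) ×ˢ univ))
    (hmild : ∀ s t : ℝ, s < t → t < 0 → ∀ x,
      v t x = UnboundedOperators.heatExtension (v s) (t - s) x - oseenDuhamel 1 s v v t x)
    (hdiv : ∀ t < 0, VectorCalculus.IsDivFree (v t))
    (hpol : ∀ s < 0, ∀ y, ⟪curl (v s) y, EuclideanSpace.single 2 1⟫_ℝ = 0)
    {W : Set (ℝ × EuclideanSpace ℝ (Fin 3))} (hW : IsOpen W) (hWne : W.Nonempty) (hWs : W ⊆ Iio (0 : ℝ) ×ˢ univ)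
    (hnd : ∀ z ∈ W, fderiv ℝ (v z.1) z.2 (EuclideanSpace.single 0 1) 2 ≠ 0 ∨ fderiv ℝ (v z.1) z.2 (EuclideanSpace.single 1 1) 2 ≠ 0)
    (hthick : ∀ m : ℝ → ℝ → ℝ, ∀ W₁ : Set (ℝ × EuclideanSpace ℝ (Fin 3)), W₁ ⊆ W → IsOpen W₁ → W₁.Nonempty →
      ∃ z ∈ W₁, ∃ b : Fin 3, b ≠ 2 ∧
        fderiv ℝ (v z.1) z.2 (EuclideanSpace.single 2 1) b ≠ m z.1 (z.2 2) * fderiv ℝ (v z.1) z.2 (EuclideanSpace.single b 1) 2) :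
    ∃ U : Set (ℝ × EuclideanSpace ℝ (Fin 3)), U ⊆ W ∧ IsOpen U ∧ U.Nonempty ∧ ∀ p ∈ U,
      fderiv ℝ (fun y => (fderiv ℝ (v p.1) y (EuclideanSpace.single 2 1) 0 * fderiv ℝ (v p.1) y (EuclideanSpace.single 0 1) 2 +
              fderiv ℝ (v p.1) y (EuclideanSpace.single 2 1) 1 * fderiv ℝ (v p.1) y (EuclideanSpace.single 1 1) 2) /
            (fderiv ℝ (v p.1) y (EuclideanSpace.single 0 1) 2 ^ 2 + fderiv ℝ (v p.1) y (EuclideanSpace.single 1 1) 2 ^ 2)) p.2 (EuclideanSpace.single 0 1) ≠ 0 ∨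
      fderiv ℝ (fun y => (fderiv ℝ (v p.1) y (EuclideanSpace.single 2 1) 0 * fderiv ℝ (v p.1) y (EuclideanSpace.single 0 1) 2 +
              fderiv ℝ (v p.1) y (EuclideanSpace.single 2 1) 1 * fderiv ℝ (v p.1) y (EuclideanSpace.single 1 1) 2) /
            (fderiv ℝ (v p.1) y (EuclideanSpace.single 0 1) 2 ^ 2 + fderiv ℝ (v p.1) y (EuclideanSpace.single 1 1) 2 ^ 2)) p.2 (EuclideanSpace.single 1 1) ≠ 0 := by
  have hneg : ∀ z ∈ W, z.1 < 0 := fun z hz => (Set.mem_prod.1 (hWs hz)).1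
  have hfrW : ∀ z ∈ W,
      fderiv ℝ (v z.1) z.2 (EuclideanSpace.single 2 1) 0 * fderiv ℝ (v z.1) z.2 (EuclideanSpace.single 1 1) 2 =
        fderiv ℝ (v z.1) z.2 (EuclideanSpace.single 2 1) 1 * fderiv ℝ (v z.1) z.2 (EuclideanSpace.single 0 1) 2 :=
    fun z hz => frozen_coord hrate hcont hmild hdiv hpol (hneg z hz) z.2
  -- ## the ratio `Λ` and its joint analyticity on the window
  set Λv : ℝ → EuclideanSpace ℝ (Fin 3) → ℝ := fun t y =>
    (fderiv ℝ (v t) y (EuclideanSpace.single 2 1) 0 * fderiv ℝ (v t) y (EuclideanSpace.single 0 1) 2 +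
        fderiv ℝ (v t) y (EuclideanSpace.single 2 1) 1 * fderiv ℝ (v t) y (EuclideanSpace.single 1 1) 2) /
      (fderiv ℝ (v t) y (EuclideanSpace.single 0 1) 2 ^ 2 + fderiv ℝ (v t) y (EuclideanSpace.single 1 1) 2 ^ 2) with hΛv
  have hent : ∀ j i : Fin 3, ∀ z ∈ W,
      AnalyticAt ℝ (uncurry fun s y => fderiv ℝ (v s) y (EuclideanSpace.single j 1) i) z :=
    fun j i z hz => analyticOnNhd_uncurry_fderiv_entry hrate hcont hmild j i z (hWs hz)
  have hΛan : ∀ z ∈ W, AnalyticAt ℝ (uncurry Λv) z := by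
    intro z hz
    have hden : (uncurry fun s y => fderiv ℝ (v s) y (EuclideanSpace.single 0 1) 2 ^ 2 +
        fderiv ℝ (v s) y (EuclideanSpace.single 1 1) 2 ^ 2) z ≠ 0 := by
      rcases hnd z hz with h | h
      · have h' : 0 < fderiv ℝ (v z.1) z.2 (EuclideanSpace.single 0 1) 2 ^ 2 := by positivity
        have := sq_nonneg (fderiv ℝ (v z.1) z.2 (EuclideanSpace.single 1 1) 2)
        exact ne_of_gt (by simp only [uncurry]; linarith)
      · have h' : 0 < fderiv ℝ (v z.1) z.2 (EuclideanSpace.single 1 1) 2 ^ 2 := by positivity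
        have := sq_nonneg (fderiv ℝ (v z.1) z.2 (EuclideanSpace.single 0 1) 2)
        exact ne_of_gt (by simp only [uncurry]; linarith)
    have hnum : AnalyticAt ℝ (uncurry fun s y =>
        fderiv ℝ (v s) y (EuclideanSpace.single 2 1) 0 * fderiv ℝ (v s) y (EuclideanSpace.single 0 1) 2 +
          fderiv ℝ (v s) y (EuclideanSpace.single 2 1) 1 * fderiv ℝ (v s) y (EuclideanSpace.single 1 1) 2) z :=
      ((hent 2 0 z hz).mul (hent 0 2 z hz)).add ((hent 2 1 z hz).mul (hent 1 2 z hz))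
    have hden' : AnalyticAt ℝ (uncurry fun s y => fderiv ℝ (v s) y (EuclideanSpace.single 0 1) 2 ^ 2 +
        fderiv ℝ (v s) y (EuclideanSpace.single 1 1) 2 ^ 2) z :=
      ((hent 0 2 z hz).pow 2).add ((hent 1 2 z hz).pow 2)
    exact hnum.div hden' hden
  have hG : ∀ b : Fin 3, ∀ z ∈ W,
      ContinuousAt (uncurry fun t y => fderiv ℝ (Λv t) y (EuclideanSpace.single b 1)) z :=
    fun b z hz => (analyticAt_uncurry_fderiv_slice_apply (hΛan z hz) (EuclideanSpace.single b 1)).continuousAt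
  by_cases hA : ∃ p₀ ∈ W, fderiv ℝ (Λv p₀.1) p₀.2 (EuclideanSpace.single 0 1) ≠ 0 ∨
      fderiv ℝ (Λv p₀.1) p₀.2 (EuclideanSpace.single 1 1) ≠ 0
  · -- ## Case A: the open sub-window `{∇ₕΛ ≠ 0}` is nonempty
    obtain ⟨p₀, hp₀, hp₀'⟩ := hA
    refine ⟨{z | z ∈ W ∧ (fderiv ℝ (Λv z.1) z.2 (EuclideanSpace.single 0 1) ≠ 0 ∨
        fderiv ℝ (Λv z.1) z.2 (EuclideanSpace.single 1 1) ≠ 0)}, fun z hz => hz.1, ?_, ⟨p₀, hp₀, hp₀'⟩, fun p hp => hp.2⟩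
    rw [isOpen_iff_mem_nhds]
    rintro z ⟨hzW, hz⟩
    have hWn : W ∈ 𝓝 z := hW.mem_nhds hzW
    rcases hz with h | h
    · have h0 := (hG 0 z hzW).eventually_ne h
      filter_upwards [hWn, h0] with z' hz'W hz'
      exact ⟨hz'W, Or.inl hz'⟩
    · have h1 := (hG 1 z hzW).eventually_ne h
      filter_upwards [hWn, h1] with z' hz'W hz'
      exact ⟨hz'W, Or.inr hz'⟩
  · -- ## Case B: `∇ₕΛ ≡ 0` on the window — a ball of the window is time–height, contradicting thickness
    exfalso
    push Not at hA
    obtain ⟨z₀, hz₀⟩ := hWne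
    obtain ⟨r, hr, hball⟩ := Metric.isOpen_iff.1 hW z₀ hz₀
    set m : ℝ → ℝ → ℝ := fun t z => Λv t (z₀.2 + (z - z₀.2 2) • EuclideanSpace.single 2 (1 : ℝ)) with hm
    obtain ⟨p, hp, b, hb, hne⟩ := hthick m (ball z₀ r) hball isOpen_ball ⟨z₀, mem_ball_self hr⟩
    apply hne
    have hpW : p ∈ W := hball hp
    have hratio := eq_ratio_mul_of_frozen (hfrW p hpW) (hnd p hpW)
    have hsec : ∀ y ∈ {y : EuclideanSpace ℝ (Fin 3) | (p.1, y) ∈ ball z₀ r}, (p.1, y) ∈ W := fun y hy => hball hy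
    have hconst : Λv p.1 p.2 = Λv p.1 (z₀.2 + (p.2 2 - z₀.2 2) • EuclideanSpace.single 2 (1 : ℝ)) :=
      eq_of_horizontal_fderiv_eq_zero (convex_section_ball z₀ r p.1)
        (fun y hy => (analyticAt_slice (hΛan _ (hsec y hy))).differentiableAt)
        (fun y hy => (hA _ (hsec y hy)).1) (fun y hy => (hA _ (hsec y hy)).2) hp (mem_ball_of_sameHeight hp)
        (by simp)
    have hmval : m p.1 (p.2 2) = Λv p.1 p.2 := hconst.symm
    rw [hmval]
    have hΛp : Λv p.1 p.2 =
        (fderiv ℝ (v p.1) p.2 (EuclideanSpace.single 2 1) 0 * fderiv ℝ (v p.1) p.2 (EuclideanSpace.single 0 1) 2 +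
            fderiv ℝ (v p.1) p.2 (EuclideanSpace.single 2 1) 1 * fderiv ℝ (v p.1) p.2 (EuclideanSpace.single 1 1) 2) /
          (fderiv ℝ (v p.1) p.2 (EuclideanSpace.single 0 1) 2 ^ 2 + fderiv ℝ (v p.1) p.2 (EuclideanSpace.single 1 1) 2 ^ 2) := by
      rw [hΛv]
    rw [hΛp]
    fin_cases b
    · exact hratio.1
    · exact hratio.2
    · exact absurd rfl hb

/-! ### The registered stub of item 20428's line `twist_split` (v4), from the type-blind local statement -/

/-- **`stub_twistingThick` (`Cruxes/LrcModEntire/Lines/twist_split.lean` v4, item 20428) VERBATIM, from the type-blind pointwise-open local statement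
`hthick`** («no real-analytic classical NS pair on a nonempty open set is everywhere poloidal, frozen, non-degenerate, twisting with `∇ₕΛ ≠ 0`»).
Proof: classical pressure on the slab and joint analyticity (tree), `exists_isOpen_slopeGrad_ne_zero` on the window, `hthick` on the resulting open
sub-window (to which the class solution, poloidality, the frozen identity, non-degeneracy and the twist restrict) — ex falso the germ trichotomy. -/
theorem stub_twistingThick_of_localThickOpen
    (hthick : ∀ (u : ℝ → EuclideanSpace ℝ (Fin 3) → EuclideanSpace ℝ (Fin 3)) (q : ℝ → EuclideanSpace ℝ (Fin 3) → ℝ)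
        (U : Set (ℝ × EuclideanSpace ℝ (Fin 3))),
        IsOpen U → U.Nonempty →
        Literature.Analysis.FluidPDE.IsClassicalNSSolutionOnRegion U 1 0 u q →
        AnalyticOnNhd ℝ (Function.uncurry u) U →
        (∀ p ∈ U, ⟪Literature.Analysis.FluidPDE.curl (u p.1) p.2, EuclideanSpace.single 2 1⟫_ℝ = 0) →
        (∀ p ∈ U, fderiv ℝ (u p.1) p.2 (EuclideanSpace.single 2 1) 0 * fderiv ℝ (u p.1) p.2 (EuclideanSpace.single 1 1) 2 =
          fderiv ℝ (u p.1) p.2 (EuclideanSpace.single 2 1) 1 * fderiv ℝ (u p.1) p.2 (EuclideanSpace.single 0 1) 2) →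
        (∀ p ∈ U, Literature.Analysis.FluidPDE.curl (u p.1) p.2 ≠ 0 ∧
          (fderiv ℝ (u p.1) p.2 (EuclideanSpace.single 0 1) 2 ≠ 0 ∨ fderiv ℝ (u p.1) p.2 (EuclideanSpace.single 1 1) 2 ≠ 0) ∧
          (fderiv ℝ (u p.1) p.2 (EuclideanSpace.single 2 1) 0 ≠ 0 ∨ fderiv ℝ (u p.1) p.2 (EuclideanSpace.single 2 1) 1 ≠ 0)) →
        (∀ p ∈ U,
          fderiv ℝ (fun y => fderiv ℝ (u p.1) y (EuclideanSpace.single 2 1) 2) p.2 (EuclideanSpace.single 0 1) *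
              fderiv ℝ (u p.1) p.2 (EuclideanSpace.single 1 1) 2 -
            fderiv ℝ (fun y => fderiv ℝ (u p.1) y (EuclideanSpace.single 2 1) 2) p.2 (EuclideanSpace.single 1 1) *
              fderiv ℝ (u p.1) p.2 (EuclideanSpace.single 0 1) 2 ≠ 0) →
        (∀ p ∈ U,
          fderiv ℝ (fun y => (fderiv ℝ (u p.1) y (EuclideanSpace.single 2 1) 0 * fderiv ℝ (u p.1) y (EuclideanSpace.single 0 1) 2 +
              fderiv ℝ (u p.1) y (EuclideanSpace.single 2 1) 1 * fderiv ℝ (u p.1) y (EuclideanSpace.single 1 1) 2) /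
            (fderiv ℝ (u p.1) y (EuclideanSpace.single 0 1) 2 ^ 2 + fderiv ℝ (u p.1) y (EuclideanSpace.single 1 1) 2 ^ 2)) p.2 (EuclideanSpace.single 0 1) ≠ 0 ∨
          fderiv ℝ (fun y => (fderiv ℝ (u p.1) y (EuclideanSpace.single 2 1) 0 * fderiv ℝ (u p.1) y (EuclideanSpace.single 0 1) 2 +
              fderiv ℝ (u p.1) y (EuclideanSpace.single 2 1) 1 * fderiv ℝ (u p.1) y (EuclideanSpace.single 1 1) 2) /
            (fderiv ℝ (u p.1) y (EuclideanSpace.single 0 1) 2 ^ 2 + fderiv ℝ (u p.1) y (EuclideanSpace.single 1 1) 2 ^ 2)) p.2 (EuclideanSpace.single 1 1) ≠ 0) →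
        False) :
    ∀ (C : ℝ) (v : ℝ → EuclideanSpace ℝ (Fin 3) → EuclideanSpace ℝ (Fin 3)),
      Literature.Analysis.FluidPDE.HasTypeITimeDecay C v →
      ContinuousOn (Function.uncurry v) (Set.Iio (0 : ℝ) ×ˢ Set.univ) →
      (∀ s t : ℝ, s < t → t < 0 → ∀ x, v t x =
        Literature.Analysis.UnboundedOperators.heatExtension (v s) (t - s) x -
          Literature.Analysis.FluidPDE.oseenDuhamel 1 s v v t x) →
      (∀ t < 0, Literature.Analysis.FluidPDE.VectorCalculus.IsDivFree (v t)) →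
      (∀ s < 0, ∀ y, ⟪Literature.Analysis.FluidPDE.curl (v s) y, EuclideanSpace.single 2 1⟫_ℝ = 0) →
      ∀ W : Set (ℝ × EuclideanSpace ℝ (Fin 3)), IsOpen W → W.Nonempty → W ⊆ Set.Iio (0 : ℝ) ×ˢ Set.univ →
        (∀ z ∈ W, Literature.Analysis.FluidPDE.curl (v z.1) z.2 ≠ 0 ∧
          (fderiv ℝ (v z.1) z.2 (EuclideanSpace.single 0 1) 2 ≠ 0 ∨ fderiv ℝ (v z.1) z.2 (EuclideanSpace.single 1 1) 2 ≠ 0) ∧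
          (fderiv ℝ (v z.1) z.2 (EuclideanSpace.single 2 1) 0 ≠ 0 ∨ fderiv ℝ (v z.1) z.2 (EuclideanSpace.single 2 1) 1 ≠ 0)) →
        (∀ m : ℝ → ℝ, ∀ W₁ : Set (ℝ × EuclideanSpace ℝ (Fin 3)), W₁ ⊆ W → IsOpen W₁ → W₁.Nonempty →
          ∃ z ∈ W₁, ∃ b : Fin 3, b ≠ 2 ∧
            fderiv ℝ (v z.1) z.2 (EuclideanSpace.single 2 1) b ≠
              m z.1 * fderiv ℝ (v z.1) z.2 (EuclideanSpace.single b 1) 2) →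
        (∀ z ∈ W,
          fderiv ℝ (fun x => fderiv ℝ (v z.1) x (EuclideanSpace.single 2 1) 2) z.2 (EuclideanSpace.single 0 1) *
              fderiv ℝ (v z.1) z.2 (EuclideanSpace.single 1 1) 2 -
            fderiv ℝ (fun x => fderiv ℝ (v z.1) x (EuclideanSpace.single 2 1) 2) z.2 (EuclideanSpace.single 1 1) *
              fderiv ℝ (v z.1) z.2 (EuclideanSpace.single 0 1) 2 ≠ 0) →
        (∀ m : ℝ → ℝ → ℝ, ∀ W₁ : Set (ℝ × EuclideanSpace ℝ (Fin 3)), W₁ ⊆ W → IsOpen W₁ → W₁.Nonempty →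
          ∃ z ∈ W₁, ∃ b : Fin 3, b ≠ 2 ∧
            fderiv ℝ (v z.1) z.2 (EuclideanSpace.single 2 1) b ≠
              m z.1 (z.2 2) * fderiv ℝ (v z.1) z.2 (EuclideanSpace.single b 1) 2) →
        ∃ s : ℝ, s < 0 ∧ ∃ U : Set (EuclideanSpace ℝ (Fin 3)), IsOpen U ∧ U.Nonempty ∧
          ((∃ e : EuclideanSpace ℝ (Fin 3), e ≠ 0 ∧
              ∀ y ∈ U, fderiv ℝ (Literature.Analysis.FluidPDE.curl (v s)) y e = 0) ∨
           (∃ c : EuclideanSpace ℝ (Fin 3), ∀ y ∈ U,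
              Literature.Analysis.FluidPDE.rotGen (Literature.Analysis.FluidPDE.curl (v s) y) =
                fderiv ℝ (Literature.Analysis.FluidPDE.curl (v s)) y (Literature.Analysis.FluidPDE.rotGen (y - c))) ∨
           (∃ w : EuclideanSpace ℝ (Fin 3) → EuclideanSpace ℝ (Fin 3), AnalyticOnNhd ℝ w Set.univ ∧
              ¬ BddAbove (Set.range fun y => ‖w y‖) ∧ ∀ y ∈ U, v s y = w y)) := by
  intro C v hrate hcont hmild hdiv hpol W hW hWne hWs hnd _hpin htw hth
  exfalso
  -- ## the class profile: classical with a pressure on the window, jointly analytic, frozen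
  obtain ⟨q, hq⟩ := exists_isClassicalNSSolutionOn_Iio_of_isTypeIAncientMild (isTypeIAncientMild_of_class hrate hcont hmild hdiv)
  have hreg : IsClassicalNSSolutionOnRegion W 1 0 v q := hq.onRegion.mono_of_isOpen hWs hW
  have han : AnalyticOnNhd ℝ (uncurry v) W := fun z hz =>
    (analyticOnNhd_uncurry hcont (bdd_of_hasTypeITimeDecay hrate) hmild) z (hWs hz)
  have hpolW : ∀ z ∈ W, ⟪curl (v z.1) z.2, EuclideanSpace.single 2 1⟫_ℝ = 0 := fun z hz =>
    hpol z.1 (Set.mem_prod.1 (hWs hz)).1 z.2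
  have hfrW : ∀ z ∈ W,
      fderiv ℝ (v z.1) z.2 (EuclideanSpace.single 2 1) 0 * fderiv ℝ (v z.1) z.2 (EuclideanSpace.single 1 1) 2 =
        fderiv ℝ (v z.1) z.2 (EuclideanSpace.single 2 1) 1 * fderiv ℝ (v z.1) z.2 (EuclideanSpace.single 0 1) 2 :=
    fun z hz => frozen_coord hrate hcont hmild hdiv hpol (Set.mem_prod.1 (hWs hz)).1 z.2
  -- ## the open sub-window with `∇ₕΛ ≠ 0`, and `hthick` on it
  obtain ⟨U, hUW, hUo, hUne, hpinU⟩ :=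
    exists_isOpen_slopeGrad_ne_zero hrate hcont hmild hdiv hpol hW hWne hWs (fun z hz => (hnd z hz).2.1) hth
  exact hthick v q U hUo hUne (hreg.mono_of_isOpen hUW hUo) (fun z hz => han z (hUW hz))
    (fun p hp => hpolW p (hUW hp)) (fun p hp => hfrW p (hUW hp)) (fun p hp => hnd p (hUW hp))
    (fun p hp => htw p (hUW hp)) hpinU

end Summit.NavierStokesRegularity.NavierStokesRegularity.Theorems.PoloidalWindowDoorLrcModEntireTwistingThickOfLocalOpen

end
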